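import Literature.Probability.Percolation.SiteSharpnessStep
import Literature.Probability.LatticeModels.TriangularLattice
import HarnessLib

/-!
# Sharpness of the phase transition for site percolation, II: exponential decay when `ψ_p(S) < 1`

Topic `Literature/Probability/Percolation`. Third layer of the discharge of
`Literature.Probability.Percolation.triCriticalProb_eq_half` (Kesten 1982, §3.4: `p_c^site(𝕋) = 1/2`). Item 1 of
Duminil-Copin–Tassion's Thm. 1.1 (*Enseign. Math.* 62 (2016), proof in §2.1; general version
*Comm. Math. Phys.* 343 (2016), Thm. 1.1 item 3, §1.4), site version, on the
triangular lattice `𝕋`: if `ψ_p(S) < 1` for some finite `S ∋ 0` (`dctPhi`,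
`SiteSharpnessStep.lean`), then the one-arm probabilities `θ_n(p) = P_p(0 ⟷ ∂ⁱⁿΛ(n) in Λ(n))`,
`Λ(n) = [-n, n]²`, decay exponentially: `θ_n(p) ≤ ψ_p(S)^k` for `n ≥ k L` when `S ⊆ Λ(L)`
(`tri_real_exitEvent_box_le_dctPhi_pow`; DCT, Enseign. Math. §2.1: "since `y ∈ Λ_L`, one can
bound `P_p[y ⟷ ∂Λ_{kL}]` by `P_p[0 ⟷ ∂Λ_{(k-1)L}]` … which by induction gives" the bound
`φ_p(S)^{k}`).

General tools (arbitrary locally finite graphs):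
* `exitEvent_anti` — `{z ⟷ ∂ⁱⁿΛ in Λ} ⊆ {z ⟷ ∂ⁱⁿΛ' in Λ'}` for `z ∈ Λ' ⊆ Λ` (first exit from `Λ'`);
* `innerBoundary_image_iso`, `relabel_preimage_exitEvent`, `sitePercolation_real_exitEvent_iso` —
  transport of exit events along graph isomorphisms (`P_p` is invariant).
Triangular lattice: translation invariance of one-arm probabilities (`tri_real_exitEvent_shift`,
translations being automorphisms of `𝕋`, `triGraph_adj_shift_iff`), and the one-step bound in
boxes `tri_real_exitEvent_box_le` (`θ_n ≤ ψ_p(S) θ_{n-L}`, from `real_exitEvent_le_dctPhi_mul`).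

## References

* H. Duminil-Copin, V. Tassion, A new proof of the sharpness of the phase transition for
  Bernoulli percolation on `ℤ^d`, *Enseign. Math.* 62 (2016) 199–206, Thm. 1.1 item 1, §2.1
  [DuminilCopinTassionEM2016].
* H. Duminil-Copin, V. Tassion, *Comm. Math. Phys.* 343 (2016) 725–745, Thm. 1.1 item 3, §1.4
  [DuminilCopinTassionCMP2016].
* H. Kesten, *Percolation theory for mathematicians*, Birkhäuser 1982, §3.4.

## Mathlib / tree

Mathlib: `Finset.image`, `SimpleGraph.Iso`. Tree: `box`, `mem_box`, `box_mono`, `Site.shift`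
(`ThermodynamicLimit.lean`, `LatticeGraph.lean`), `image_add_box_subset`,
`relabel_mem_siteConnIn_iff`, `sitePercolation_real_preimage_relabel` (`SiteConnectionTools.lean`,
`SitePercolationMeasure.lean`), `triGraph_adj_shift_iff` (`TriangularLattice.lean`), `exitEvent`
(`SiteMonotonicity.lean`), `PathIn` (`SitePaths.lean`), `dctPhi`, `siteInterior`,
`real_exitEvent_le_dctPhi_mul` (`SiteSharpnessStep.lean`).
-/

noncomputable section

open MeasureTheory

namespace Literature.Probability.Percolation

variable {V W : Type*}

/-! ### Exit events shrink with the box and are transported by isomorphisms -/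

section General

variable {G : SimpleGraph V} [DecidableEq V] [G.LocallyFinite]

/-- **Exit events are antitone in the set**: for `z ∈ Λ' ⊆ Λ`, an open path in `Λ` from `z` to
`∂ⁱⁿΛ` either stays in `Λ'` (and then ends in `∂ⁱⁿΛ'`) or first leaves `Λ'` through a site of
`∂ⁱⁿΛ'`. [folklore] -/
theorem exitEvent_anti {Λ Λ' : Finset V} (hΛ : Λ' ⊆ Λ) {z : V} (hz : z ∈ Λ') :
    exitEvent G Λ z ⊆ exitEvent G Λ' z := by
  intro ω hω
  obtain ⟨b, hb, hzb⟩ := mem_exitEvent_iff.1 hω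
  have hpath : PathIn G (↑Λ ∩ ω) z b := PathIn.of_mem_siteConnIn hzb
  rcases hpath.exit_or (R := (↑Λ' : Set V)) (Finset.mem_coe.2 hz) with h | ⟨a, c, ha, hc, hcA, hac, hza⟩
  · -- the path stays in `Λ'`; its endpoint is an inner boundary site of `Λ'` too
    have hbΛ' : b ∈ Λ' := Finset.mem_coe.1 h.right_mem.1
    obtain ⟨-, y, hyΛ, hby⟩ := LatticeModels.mem_innerBoundary_iff.1 hb
    refine mem_exitEvent_iff.2 ⟨b, LatticeModels.mem_innerBoundary_iff.2 ⟨hbΛ', y, fun hy => hyΛ (hΛ hy), hby⟩,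
      PathIn.mem_siteConnIn (h.mono ?_)⟩
    rintro u ⟨hu, -, huω⟩
    exact ⟨hu, huω⟩
  · -- the path leaves `Λ'` at `a ∼ c`
    refine mem_exitEvent_iff.2 ⟨a, LatticeModels.mem_innerBoundary_iff.2 ⟨Finset.mem_coe.1 ha, c,
      mt Finset.mem_coe.2 hc, hac⟩, PathIn.mem_siteConnIn (hza.mono ?_)⟩
    rintro u ⟨hu, -, huω⟩
    exact ⟨hu, huω⟩

variable {G' : SimpleGraph W} [DecidableEq W] [G'.LocallyFinite]

/-- Graph isomorphisms transport inner boundaries: `∂ⁱⁿ(φ Λ) = φ(∂ⁱⁿΛ)`. [folklore] -/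
theorem innerBoundary_image_iso (φ : G ≃g G') (Λ : Finset V) :
    LatticeModels.innerBoundary G' (Λ.image φ) = (LatticeModels.innerBoundary G Λ).image φ := by
  ext w
  simp only [LatticeModels.mem_innerBoundary_iff, Finset.mem_image]
  constructor
  · rintro ⟨⟨b, hb, rfl⟩, y, hy, hby⟩
    refine ⟨b, ⟨hb, φ.symm y, fun h => hy ⟨φ.symm y, h, φ.apply_symm_apply y⟩, ?_⟩, rfl⟩
    have := φ.symm.map_rel_iff.2 hby
    simpa using this
  · rintro ⟨b, ⟨hb, y, hy, hby⟩, rfl⟩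
    refine ⟨⟨b, hb, rfl⟩, φ y, ?_, φ.map_rel_iff.2 hby⟩
    rintro ⟨y', hy', hyy'⟩
    exact hy (φ.injective hyy' ▸ hy')

/-- Graph isomorphisms transport exit events:
`(relabel φ)⁻¹' {φ x ⟷ ∂ⁱⁿ(φ Λ) in φ Λ} = {x ⟷ ∂ⁱⁿΛ in Λ}`. [folklore] -/
theorem relabel_preimage_exitEvent (φ : G ≃g G') (Λ : Finset V) (x : V) :
    SiteConfig.relabel φ.toEquiv ⁻¹' exitEvent G' (Λ.image φ) (φ x) = exitEvent G Λ x := by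
  ext ω
  simp only [Set.mem_preimage, mem_exitEvent_iff, innerBoundary_image_iso, Finset.mem_image]
  constructor
  · rintro ⟨_, ⟨b, hb, rfl⟩, h⟩
    refine ⟨b, hb, (relabel_mem_siteConnIn_iff φ ω ↑Λ x b).1 ?_⟩
    rwa [← Finset.coe_image]
  · rintro ⟨b, hb, h⟩
    refine ⟨φ b, ⟨b, hb, rfl⟩, ?_⟩
    have := (relabel_mem_siteConnIn_iff φ ω ↑Λ x b).2 h
    rwa [← Finset.coe_image] at this

/-- **Invariance of exit probabilities under graph isomorphisms**:
`P_p(φ x ⟷ ∂ⁱⁿ(φ Λ) in φ Λ) = P_p(x ⟷ ∂ⁱⁿΛ in Λ)`. [folklore] -/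
theorem sitePercolation_real_exitEvent_iso (φ : G ≃g G') (p : unitInterval) (Λ : Finset V)
    (x : V) :
    (sitePercolation W p).real (exitEvent G' (Λ.image φ) (φ x)) =
      (sitePercolation V p).real (exitEvent G Λ x) := by
  rw [← sitePercolation_real_preimage_relabel φ.toEquiv p, relabel_preimage_exitEvent]

end General

/-! ### Translations of the triangular lattice -/

/-- Every site of `ℤ^d` lies in some box `Λ(m)` (take `m = Σ_j |z_j|`). [folklore] -/
theorem exists_mem_box {d : ℕ} (z : LatticeModels.Site d) : ∃ m : ℕ, z ∈ LatticeModels.box d m := by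
  refine ⟨∑ j, (z j).natAbs, LatticeModels.mem_box.2 fun i => ?_⟩
  have h : (z i).natAbs ≤ ∑ j, (z j).natAbs :=
    Finset.single_le_sum (fun j _ => Nat.zero_le (z j).natAbs) (Finset.mem_univ i)
  have h' : ((z i).natAbs : ℤ) ≤ ((∑ j, (z j).natAbs : ℕ) : ℤ) := by exact_mod_cast h
  rw [Int.natCast_natAbs] at h'
  exact abs_le.1 h'

/-- **Translation invariance of one-arm probabilities on `𝕋`**:
`P_p(v ⟷ ∂ⁱⁿ(Λ + v) in Λ + v) = P_p(0 ⟷ ∂ⁱⁿΛ in Λ)`. [folklore] -/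
theorem tri_real_exitEvent_shift (p : unitInterval) (Λ : Finset (LatticeModels.Site 2)) (v : LatticeModels.Site 2) :
    (sitePercolation (LatticeModels.Site 2) p).real (exitEvent LatticeModels.triGraph (Λ.image (· + v)) v) =
      (sitePercolation (LatticeModels.Site 2) p).real (exitEvent LatticeModels.triGraph Λ 0) := by
  -- translation by `v` is an automorphism of `𝕋` (`triGraph_adj_shift_iff`)
  let φ : LatticeModels.triGraph ≃g LatticeModels.triGraph := ⟨LatticeModels.Site.shift v, fun {a b} => LatticeModels.triGraph_adj_shift_iff v a b⟩
  have h := sitePercolation_real_exitEvent_iso φ p Λ 0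
  have h1 : Λ.image φ = Λ.image (· + v) := rfl
  have h2 : φ 0 = v := zero_add v
  rwa [h1, h2] at h

/-! ### One step and iteration in boxes -/

/-- **One step** (Duminil-Copin–Tassion, Enseign. Math. 2016, §2.1, site version on `𝕋`): if
`S ⊆ Λ(L)` with `0`
interior to `S` and `L ≤ n`, then `θ_n(p) ≤ ψ_p(S) · θ_{n-L}(p)`, where
`θ_m(p) = P_p(0 ⟷ ∂ⁱⁿΛ(m) in Λ(m))`: each `z ∈ ∂ⁱⁿS ⊆ Λ(L)` has `z + Λ(n - L) ⊆ Λ(n)`, so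
`P_p(z ⟷ ∂ⁱⁿΛ(n)) ≤ P_p(z ⟷ ∂ⁱⁿ(z + Λ(n-L))) = θ_{n-L}(p)` by translation invariance. [cite: DuminilCopinTassionEM2016, §2.1 (proof of Thm. 1.1, item 1)] -/
theorem tri_real_exitEvent_box_le (p : unitInterval) {S : Finset (LatticeModels.Site 2)} {L n : ℕ}
    (hS : S ⊆ LatticeModels.box 2 L) (h0 : (0 : LatticeModels.Site 2) ∈ siteInterior LatticeModels.triGraph S) (hLn : L ≤ n) :
    (sitePercolation (LatticeModels.Site 2) p).real (exitEvent LatticeModels.triGraph (LatticeModels.box 2 n) 0) ≤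
      dctPhi LatticeModels.triGraph p S 0 *
        (sitePercolation (LatticeModels.Site 2) p).real (exitEvent LatticeModels.triGraph (LatticeModels.box 2 (n - L)) 0) := by
  refine real_exitEvent_le_dctPhi_mul p (hS.trans (LatticeModels.box_mono 2 hLn)) h0 fun z hz => ?_
  have hzL : z ∈ LatticeModels.box 2 L := hS ((LatticeModels.mem_innerBoundary_iff.1 hz).1)
  have hsub : (LatticeModels.box 2 (n - L)).image (· + z) ⊆ LatticeModels.box 2 n := by
    have := image_add_box_subset (n := n - L) hzL
    rwa [Nat.add_sub_cancel' hLn] at this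
  have hz0 : z ∈ (LatticeModels.box 2 (n - L)).image (· + z) :=
    Finset.mem_image.2 ⟨0, LatticeModels.zero_mem_box 2 _, zero_add z⟩
  calc (sitePercolation (LatticeModels.Site 2) p).real (exitEvent LatticeModels.triGraph (LatticeModels.box 2 n) z)
      ≤ (sitePercolation (LatticeModels.Site 2) p).real (exitEvent LatticeModels.triGraph ((LatticeModels.box 2 (n - L)).image (· + z)) z) :=
        measureReal_mono (exitEvent_anti hsub hz0) (measure_ne_top _ _)
    _ = (sitePercolation (LatticeModels.Site 2) p).real (exitEvent LatticeModels.triGraph (LatticeModels.box 2 (n - L)) 0) :=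
        tri_real_exitEvent_shift p _ z

/-- **Exponential decay from `ψ_p(S) < 1`** (Duminil-Copin–Tassion, Enseign. Math. 2016, Thm. 1.1
item 1, proof in §2.1 "which by induction gives" `φ_p(S)^k`; site version on `𝕋`): if `S ⊆ Λ(L)`
with `0` interior to `S`, then for all `k` and `n ≥ k L`, `P_p(0 ⟷ ∂ⁱⁿΛ(n) in Λ(n)) ≤ ψ_p(S)^k`.
(Iterate the one-step bound.) [cite: DuminilCopinTassionEM2016, Thm. 1.1 item 1, §2.1] -/
theorem tri_real_exitEvent_box_le_dctPhi_pow (p : unitInterval) {S : Finset (LatticeModels.Site 2)} {L : ℕ}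
    (hS : S ⊆ LatticeModels.box 2 L) (h0 : (0 : LatticeModels.Site 2) ∈ siteInterior LatticeModels.triGraph S) (k : ℕ) {n : ℕ}
    (hn : k * L ≤ n) :
    (sitePercolation (LatticeModels.Site 2) p).real (exitEvent LatticeModels.triGraph (LatticeModels.box 2 n) 0) ≤
      dctPhi LatticeModels.triGraph p S 0 ^ k := by
  induction k generalizing n with
  | zero => simp [measureReal_le_one]
  | succ k ih =>
    have hLn : L ≤ n := le_trans (by nlinarith) hn
    have hk : k * L ≤ n - L := by
      rw [Nat.succ_mul] at hn
      omega
    calc (sitePercolation (LatticeModels.Site 2) p).real (exitEvent LatticeModels.triGraph (LatticeModels.box 2 n) 0)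
        ≤ dctPhi LatticeModels.triGraph p S 0 *
            (sitePercolation (LatticeModels.Site 2) p).real (exitEvent LatticeModels.triGraph (LatticeModels.box 2 (n - L)) 0) :=
          tri_real_exitEvent_box_le p hS h0 hLn
      _ ≤ dctPhi LatticeModels.triGraph p S 0 * dctPhi LatticeModels.triGraph p S 0 ^ k :=
          mul_le_mul_of_nonneg_left (ih hk) (dctPhi_nonneg p S 0)
      _ = dctPhi LatticeModels.triGraph p S 0 ^ (k + 1) := by ring

/-- **Exponential decay, packaged**: if `ψ_p(S) < 1` for some finite `S` (with `0` interior to `S`,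
which `ψ_p(S) < 1` forces up to enlarging nothing: `0 ∈ ∂ⁱⁿS` would give `ψ_p(S) ≥ 1`), then
there are `L ≥ 1` and `c < 1` with `P_p(0 ⟷ ∂ⁱⁿΛ(kL) in Λ(kL)) ≤ c^k` for all `k`.
(Duminil-Copin–Tassion, Enseign. Math. 2016, Thm. 1.1, item 1.) [cite: DuminilCopinTassionEM2016, Thm. 1.1 item 1] -/
theorem tri_exists_exp_decay_of_dctPhi_lt_one (p : unitInterval) {S : Finset (LatticeModels.Site 2)}
    (h0S : (0 : LatticeModels.Site 2) ∈ S) (hψ : dctPhi LatticeModels.triGraph p S 0 < 1) :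
    ∃ L : ℕ, 1 ≤ L ∧ ∃ c : ℝ, 0 ≤ c ∧ c < 1 ∧ ∀ k : ℕ,
      (sitePercolation (LatticeModels.Site 2) p).real (exitEvent LatticeModels.triGraph (LatticeModels.box 2 (k * L)) 0) ≤ c ^ k := by
  -- `0` is interior to `S`, for otherwise `ψ_p(S) ≥ 1`
  have h0 : (0 : LatticeModels.Site 2) ∈ siteInterior LatticeModels.triGraph S := by
    by_contra h
    exact absurd hψ (not_lt.2 (one_le_dctPhi_of_mem_innerBoundary p
      (mem_innerBoundary_of_not_mem_siteInterior h0S h)))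
  -- `S` lies in some box `Λ(L)`, `L ≥ 1`
  obtain ⟨L, hL, hS⟩ : ∃ L : ℕ, 1 ≤ L ∧ S ⊆ LatticeModels.box 2 L := by
    choose f hf using fun z : LatticeModels.Site 2 => exists_mem_box z
    refine ⟨S.sup f + 1, Nat.le_add_left 1 _, fun z hz => LatticeModels.box_mono 2 ?_ (hf z)⟩
    exact (Finset.le_sup hz).trans (Nat.le_succ _)
  exact ⟨L, hL, dctPhi LatticeModels.triGraph p S 0, dctPhi_nonneg p S 0, hψ, fun k =>
    tri_real_exitEvent_box_le_dctPhi_pow p hS h0 k le_rfl⟩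

end Literature.Probability.Percolation
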